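import Summits.FinalStateConjecture.FinalStateConjecture.Theorems.ZeroEnergyKerrOrBombHawkingExtensionIsKerrReduction
import Summits.FinalStateConjecture.FinalStateConjecture.Theorems.ZeroEnergyKerrOrBombHawkingExtensionIsKerrCollarZerothLaw
import HarnessLib

/-!
# Crux `HawkingExtensionIsKerr` (stmt-FinalStateConjecture-17840), line `SketchIdeator2` — the crux over FIVE vendored facts

Reshape r5 of the line (lead c3): the zeroth-law debt `VacuumHorizonZerothLaw` of the landed
reduction `hawkingExtensionIsKerr_of_facts` (p138226) is DISCHARGED in the collar setting by the
proved theorem `vacuumHorizonZerothLaw_of_collar` (`…CollarZerothLaw.lean`, programme "collar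
zeroth law", steps A–G).  This file re-lands the reduction with that theorem in place of the fact:
`collarSurfaceGravity_of_collar` (the collar has one non-zero surface gravity, over
`DegenerateVacuumHorizonNoCollar` only) and `hawkingExtensionIsKerr_of_five_facts` — the body of
`Theses.ZeroEnergyKerrOrBomb.HawkingExtensionIsKerr` (rev 9, verbatim) from the five remaining
Literature named facts `DegenerateVacuumHorizonNoCollar`, `SudarskyWald1993_staticity`,
`ChruscielGalloway2010_docStaticUniqueness`, `Chrusciel1997_docAxisymmetricCombination`,
`ChruscielCostaHeusler2012_docAxisymmetricUniqueness`.
-/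

noncomputable section

set_option linter.dupNamespace false

namespace Summit.FinalStateConjecture.FinalStateConjecture.Theorems.HawkingExtensionIsKerr.SketchIdeator2

open Set Function Literature.Geometry.Lorentzian
open scoped Manifold ContDiff Topology

/-- **Card B assembled over the PROVED collar zeroth law: the collar has non-zero surface
gravity.**  `K` is null and locally tangent on `𝓔⁺` (P5), `∇_K K = κ K` on `𝓔⁺` with ONE constant
`κ` (`vacuumHorizonZerothLaw_of_collar`), and `κ ≠ 0` by the near-horizon Gauss–Bonnet fact against
the timelike collar. -/
theorem collarSurfaceGravity_of_collar (hGB : DegenerateVacuumHorizonNoCollar) (𝓑 : StationaryAFBlackHole.{0})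
    [𝓑.metric.HasLeviCivita] (hvac : 𝓑.metric.toPseudoRiemannianMetric.IsRicciFlat)
    (hreg : 𝓑.IsIPlusRegular)
    (hfut : ∀ p : 𝓑.carrier, p ∈ 𝓑.metric.chronologicalFuture 𝓑.timeOrientation 𝓑.Mext)
    (hsc : SimplyConnectedSpace 𝓑.doc) {U U' : Set 𝓑.carrier}
    {K K' : Π x : 𝓑.carrier, TangentSpace (𝓡 4) x} (hU : IsOpen U) (hHU : 𝓑.horizon ⊆ U)
    (hconn : IsConnected 𝓑.horizon) (hKon : 𝓑.metric.toPseudoRiemannianMetric.IsKillingFieldOn K U)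
    (hKc : ∀ x ∈ U, VectorField.mlieBracket (𝓡 4) 𝓑.killing K x = 0)
    (hKne : ∀ p ∈ 𝓑.horizon, K p ≠ 0)
    (hKtl : ∀ x ∈ U ∩ 𝓑.doc, 𝓑.metric.val x (K x) (K x) < 0)
    (hU' : IsOpen U') (hHU' : 𝓑.horizon ⊆ U') (hK'K : ∀ x ∈ U' ∩ 𝓑.doc, K' x = K x)
    (hK'on : 𝓑.metric.toPseudoRiemannianMetric.IsKillingFieldOn K' 𝓑.doc)
    (hK'comp : ∀ x ∈ 𝓑.doc, ∃ δ : ℝ → 𝓑.carrier, IsMIntegralCurve δ K' ∧ δ 0 = x ∧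
      ∀ t, δ t ∈ 𝓑.doc) :
    ∃ κ : ℝ, κ ≠ 0 ∧ ∀ p ∈ 𝓑.horizon, 𝓑.metric.leviCivita K p (K p) = κ • K p := by
  have hNT := stub_collarNullTangent 𝓑 hfut U U' K K' hU hHU hKon hKtl hU' hHU' hK'K hK'on hK'comp
  have hnull : ∀ p ∈ 𝓑.horizon, 𝓑.metric.val p (K p) (K p) = 0 := fun p hp ↦ (hNT p hp).1
  have htan : ∀ p ∈ 𝓑.horizon, ∃ ε > (0 : ℝ), ∃ γ : ℝ → 𝓑.carrier, γ 0 = p ∧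
      IsMIntegralCurveOn γ K (Set.Ioo (-ε) ε) ∧ ∀ t ∈ Set.Ioo (-ε) ε, γ t ∈ 𝓑.horizon :=
    fun p hp ↦ (hNT p hp).2
  obtain ⟨κ, hκ⟩ := vacuumHorizonZerothLaw_of_collar 𝓑 hvac hconn hU hHU hKon hKne hnull hKtl
  refine ⟨κ, ?_, hκ⟩
  rintro rfl
  obtain ⟨x, hx, hpos⟩ := hGB 𝓑 hvac hreg hconn hsc U K hU hHU hKon hKc hKne hnull htan
    (fun p hp ↦ by rw [hκ p hp, zero_smul]) U hU hHU
  exact absurd (hKtl x hx) (not_lt.mpr hpos.le)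


/-- **The crux over the five remaining vendored facts (registered sub-goal
`hawkingExtensionIsKerr_of_five_facts`).**  The body of `ZeroEnergyKerrOrBomb.HawkingExtensionIsKerr`
(rev 9), verbatim, from the five named facts; the zeroth law is proved
(`vacuumHorizonZerothLaw_of_collar`), all glue is landed (p138226 and P1–P5). -/
theorem hawkingExtensionIsKerr_of_five_facts :
    DegenerateVacuumHorizonNoCollar → SudarskyWald1993_staticity → ChruscielGalloway2010_docStaticUniqueness → Chrusciel1997_docAxisymmetricCombination → ChruscielCostaHeusler2012_docAxisymmetricUniqueness → ∀ (𝓑 : Literature.Geometry.Lorentzian.StationaryAFBlackHole.{0}) [𝓑.metric.HasLeviCivita] [Literature.Geometry.Lorentzian.Kerr.Facts], 𝓑.metric.toPseudoRiemannianMetric.IsRicciFlat → 𝓑.IsIPlusRegular → (∀ p : 𝓑.carrier, p ∈ 𝓑.metric.chronologicalFuture 𝓑.timeOrientation 𝓑.Mext) → (∀ p ∈ 𝓑.doc, 𝓑.killing p ≠ 0) → SimplyConnectedSpace 𝓑.doc → ∀ (U : Set 𝓑.carrier) (K : Π x : 𝓑.carrier, TangentSpace (𝓡 4) x), IsOpen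 U → 𝓑.horizon ⊆ U → IsConnected 𝓑.horizon → ContMDiffOn (𝓡 4) ((𝓡 4).prod 𝓘(ℝ, Literature.Geometry.Lorentzian.E4)) ((⊤ : ℕ∞) : WithTop ℕ∞) (fun x ↦ (Bundle.TotalSpace.mk' Literature.Geometry.Lorentzian.E4 x (K x) : TangentBundle (𝓡 4) 𝓑.carrier)) U → (∀ x ∈ U, ∀ v w : TangentSpace (𝓡 4) x, 𝓑.metric.val x (𝓑.metric.leviCivita K x v) w + 𝓑.metric.val x v (𝓑.metric.leviCivita K x w) = 0) → (∀ x ∈ U, VectorField.mlieBracket (𝓡 4) 𝓑.killing K x = 0) → (∀ p ∈ 𝓑.horizon, K p ≠ 0) → (∀ γ : ℝ → 𝓑.carrier, IsMIntegralCurve γ K → γ 0 ∈ 𝓑.horizon → ∀ t, γ t ∈ 𝓑.horizon) → (∀ x ∈ U ∩ 𝓑.doc, 𝓑.metric.val x (K x) (K x) < 0) → (∃ K' : Π x : 𝓑.carrier, TangentSpace (𝓡 4) x, ContMDiffOn (𝓡 4) ((𝓡 4).prod 𝓘(ℝ, Literature.Geometry.Lorentzian.E4)) ((⊤ : ℕ∞)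 : WithTop ℕ∞) (fun x ↦ (Bundle.TotalSpace.mk' Literature.Geometry.Lorentzian.E4 x (K' x) : TangentBundle (𝓡 4) 𝓑.carrier)) 𝓑.doc ∧ (∀ x ∈ 𝓑.doc, ∀ v w : TangentSpace (𝓡 4) x, 𝓑.metric.val x (𝓑.metric.leviCivita K' x v) w + 𝓑.metric.val x v (𝓑.metric.leviCivita K' x w) = 0) ∧ (∀ x ∈ 𝓑.doc, VectorField.mlieBracket (𝓡 4) 𝓑.killing K' x = 0) ∧ ∃ U' : Set 𝓑.carrier, IsOpen U' ∧ 𝓑.horizon ⊆ U' ∧ ∀ x ∈ U' ∩ 𝓑.doc, K' x = K x) → ∃ (M a : ℝ), Literature.Geometry.Lorentzian.Kerr.IsSubextremal M a ∧ ∃ Ψ : Literature.Geometry.Lorentzian.Kerr.exterior M a → 𝓑.carrier, Function.Injective Ψ ∧ Set.range Ψ = 𝓑.doc ∧ Literature.Geometry.Lorentzian.PseudoRiemannianMetric.IsIsometricImmersion (Literature.Geometry.Lorentzian.Kerr.smoothMetric M a (Literature.Geometry.Lorentzian.Kerr.rPlus M a)).toPseudoRiemannianMetric 𝓑.metric.toPseudoRiemannianMetric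 Ψ := by
  intro hGB h₁ h₂ hCh97 hCCH 𝓑 _ _ hvac hreg hfut hT hsc U K hU hHU hconn hKs hKk hKc hKne hKtan hKtl hext
  obtain ⟨K', hK's, hK'k, hK'c, U', hU', hHU', hK'K⟩ := hext
  have hKon : 𝓑.metric.toPseudoRiemannianMetric.IsKillingFieldOn K U := ⟨hKs, hKk⟩
  have hK'on : 𝓑.metric.toPseudoRiemannianMetric.IsKillingFieldOn K' 𝓑.doc := ⟨hK's, hK'k⟩
  classical
  by_cases hrot : ∃ c : ℝ, ∀ x ∈ 𝓑.doc, K' x = c • 𝓑.killing x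
  · -- non-rotating branch
    obtain ⟨c, hc⟩ := hrot
    obtain ⟨κ, hκ, hκK⟩ := collarSurfaceGravity_of_collar hGB 𝓑 hvac hreg hfut hsc hU hHU hconn hKon hKc
      hKne hKtl hU' hHU' hK'K hK'on (docComplete_of_nonrotating 𝓑 hc)
    obtain ⟨hc0, hTne, hTκ⟩ := stub_horizonKilling_of_nonrotating 𝓑 U U' K K' c κ hU hHU hKon hU'
      hHU' hK'K hc hKne hκK hconn.nonempty
    exact kerrConclusion_of_nonrotating h₁ h₂ 𝓑 hvac hreg hconn hTne
      ⟨c⁻¹ * κ, mul_ne_zero (inv_ne_zero hc0) hκ, hTκ⟩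
  · -- rotating branch
    obtain ⟨a, b, hb, hper, hax⟩ := hCh97 𝓑 hvac hreg hconn hsc K' hK'on hK'c hrot
    obtain ⟨κ, hκ, hκK⟩ := collarSurfaceGravity_of_collar hGB 𝓑 hvac hreg hfut hsc hU hHU hconn hKon hKc
      hKne hKtl hU' hHU' hK'K hK'on (stub_docComplete_of_axial 𝓑 K' a b hreg hK'on hK'c hb hper)
    have ha : a ≠ 0 := stub_axialCollar_ne_zero 𝓑 U U' K K' a b hreg hconn hU hHU hKon hKtl hU'
      hHU' hK'K hK'on hb hper
    obtain ⟨hΦon, hΦc, hΦnt, hUU', hHUU', hχon, hχeq, hχne, hχtan, hκ', hχκ⟩ :=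
      stub_axialCollar_prep 𝓑 U U' K K' a b κ hU hHU hKon hKc hKne hKtan hU' hHU' hK'K hK'on hK'c
        hrot ha hb hκ hκK
    exact ZeroEnergyRigidity.GlobalHorizonKillingField.KerrChartTransfer.stub_kerrChartTransfer 𝓑
      (hCCH 𝓑 LorentzianMetric.isOpen_chronologicalFuture_holds_of_boundaryless
        LorentzianMetric.isOpen_chronologicalPast_holds_of_boundaryless
        PseudoRiemannianMetric.contMDiff_restrict_holds hreg hconn hvac hsc
        (a • 𝓑.killing + b • K') hΦon hΦc hper hax hΦnt (U ∩ U') ((-(b / a)) • K) (-a⁻¹)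
        (-(b / a) * κ) hUU' hHUU' hχon hχeq hχne hχtan hκ' hχκ)

end Summit.FinalStateConjecture.FinalStateConjecture.Theorems.HawkingExtensionIsKerr.SketchIdeator2

end
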